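import Summits.AtomisticToContinuum.Crystallization.Theorems.FrustratedLawDichotomyMotifLemmas

/-!
# FrustratedLawDichotomy · the MOTIF DOOR: a local discharging rule is certified ONE BOUNDED MOTIF AT A TIME

`…LocalDischargingRule` (hand-2 g12, critic row 487 (2a)) typed the restricted transfer class beneath lens-5's finite-range residual of record
`T′_7` (and `FRG_R`): a RULE `F` of range `R′`, locality radius `ρ`, bound `B`, certifying the residual SITEWISE AFTER TRANSFERS at every site of
every `7/10`-separated cluster.  A census engine (NODE-g33 §6, TAG 181 (c)) certifies such inequalities on BOUNDED MOTIFS — clusters confined to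
a ball of radius `ϱ` about a distinguished centre — by interval LP.  This file (part B; the lemmas are part A `…MotifLemmas`: the capped
fit predicate `GoodAtScale η D` — credit only sites good at a scale `≤ D`, which makes the credit local and the certificate only STRONGER —, the
extension lemma `goodAt_of_motif`, and the agreement lemmas) proves the door from motifs to clusters:

* `MotifCertificateT η₀ η₁ R A eUp κT CT D ϱ F` / `MotifCertificateF R A e₁ C D ϱ F` — the per-motif inequality: for every injective
  `7/10`-separated `z : Fin M → ℝ³` and centre `c` with ALL of `z` within `ϱ` of `z c`,
  `level(c; GoodAtScale) ≤ ½·Σ_a truncLJ R (dist (z c) (z a)) − A·m_c + netInflow F M z c`;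
* ★ `localDischargingRuleT_of_motif` / `localDischargingRuleF_of_motif` — THE DOOR: if `F` has range `R′`, locality `ρ`, bound `B`, and
  `ϱ ≥ max (R, 1, R′ + ρ, ρ, 13/10·D + 1)`, `0 ≤ κ_T, C_T, A` and the isolated-site condition `eUp + κ_T ≤ −A` (resp. `0 ≤ C`, `e₁ ≤ −A`), then the
  motif certificate implies the every-site certificate, i.e. `LocalDischargingRuleT …` (resp. `…F`), hence `T′_R` / `FRG_R` and the crux BY NAME
  (`aperiodicFrustratedLawGap_of_motifT_seven` at the residual of record `T′_7`, floor `1/324` PROVED).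
  Mechanism (all PROVED): restrict the cluster to the motif `S = {j : dist (y j) (y i) ≤ ϱ}` (`Finset.orderEmbOfFin`); the truncated site sum,
  the density proxy (`nearestDist` agrees once another atom lies within `ϱ ≥ 1`) and — by `HasRange` + `IsLocal` — the net inflow of the centre
  are THE SAME in the motif and in the cluster; a `GoodAtScale`-good centre of the motif is `GoodAt`-good in the cluster (`goodAt_of_motif`, the
  sub-cluster twin of `…LocalCloseOrderFinite.robustGood_of_deep`, gap capped at `1`); an atom with no other atom within `ϱ` is priced by the
  isolated-site condition.

So the energetic residual of column 27623 can be fed to the tree as: UP (tree number) ∧ E′ (analytic, lens-5 g34) ∧ ONE local rule `F` with a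
finite family of motif inequalities (motifs of radius `ϱ`, at most `(2ϱ/(7/10) + 1)³` atoms each by packing).  [folklore] bookkeeping; 0 sorry.
Prover hand 2, gen 12 (decomp-a2c), `--supports stmt-AtomisticToContinuum-27623`.
-/

noncomputable section

namespace Summit.AtomisticToContinuum.Crystallization.Theorems.FrustratedLawDichotomyMotifDoor

open scoped BigOperators Classical
open Literature.MathematicalPhysics.StatisticalMechanics (interactionEnergy lennardJones)
open Literature.Geometry.DiscreteGeometry (nearestDist nearestDist_le_dist le_nearestDist exists_nearestDist_eq_dist
  nearestDist_eq_zero_of_subsingleton nearestDist_nonneg)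
open Summit.AtomisticToContinuum.Crystallization.Theorems.ChargedEnergyGapNegative (E3 eStar)
open Summit.AtomisticToContinuum.Crystallization.Theorems.FrustratedLawDichotomyRangeCut
open Summit.AtomisticToContinuum.Crystallization.Theorems.FrustratedLawDichotomyTailFloor (tailFloor_holds tailFloor_seven_324)
open Summit.AtomisticToContinuum.Crystallization.Theorems.FrustratedLawDichotomyLocalPricing
open Summit.AtomisticToContinuum.Crystallization.Theorems.FrustratedLawDichotomyLocalDischargingRule
open Summit.AtomisticToContinuum.Crystallization.Theorems.FrustratedLawDichotomyMotifLemmas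

/-! ## §4. Motif certificates and THE DOOR -/

/-- **`MotifCertificateT η₀ η₁ R A eUp κT CT D ϱ F`** — the PER-MOTIF inequality beneath `T′_R`: for every injective `7/10`-separated motif `z`
(all atoms within `ϱ` of the centre `c`), with CAPPED indicators,
`eUp + κ_T·𝟙[¬ GoodAtScale η₁ D] − C_T·𝟙[GoodAtScale η₀ D] ≤ ½·Σ_a truncLJ R (dist (z c) (z a)) − A·m_c + netInflow F M z c`. -/
def MotifCertificateT (η₀ η₁ R A eUp κT CT D ϱ : ℝ) (F : TransferRule) : Prop :=
  ∀ (M : ℕ) (z : Fin M → E3), Function.Injective z → Sep z → ∀ c : Fin M, (∀ a : Fin M, dist (z a) (z c) ≤ ϱ) →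
    eUp + κT * (1 - (if GoodAtScale η₁ D z c then (1 : ℝ) else 0)) - CT * (if GoodAtScale η₀ D z c then (1 : ℝ) else 0) ≤
      (∑ a, truncLJ R (dist (z c) (z a))) / 2 - A * densityProxy z c + netInflow F M z c

/-- **`MotifCertificateF R A e₁ C D ϱ F`** — the per-motif inequality beneath `FRG_R` (level `e₁ − C·𝟙[GoodAtScale (1/20) D]`). -/
def MotifCertificateF (R A e₁ C D ϱ : ℝ) (F : TransferRule) : Prop :=
  ∀ (M : ℕ) (z : Fin M → E3), Function.Injective z → Sep z → ∀ c : Fin M, (∀ a : Fin M, dist (z a) (z c) ≤ ϱ) →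
    e₁ - C * (if GoodAtScale (1 / 20) D z c then (1 : ℝ) else 0) ≤
      (∑ a, truncLJ R (dist (z c) (z a))) / 2 - A * densityProxy z c + netInflow F M z c

/-- **THE MOTIF LEMMA** (shared core of both doors): at a site `i` of a cluster `y` with some other atom within `ϱ`, the motif
`S = {j : dist (y j) (y i) ≤ ϱ}` carries the same right-hand side as the cluster, and capped goodness of its centre implies goodness in `y`. -/
theorem motif_transfer {R R' ρ ϱ A D : ℝ} {F : TransferRule} (hF₁ : HasRange R' F) (hF₂ : IsLocal ρ F)
    (h0 : 0 ≤ ϱ) (hR : R ≤ ϱ) (hRρ : R' + ρ ≤ ϱ) (hρ : ρ ≤ ϱ) (hR' : R' ≤ ϱ) (hD : 13 / 10 * D + 1 ≤ ϱ)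
    {N : ℕ} {y : Fin N → E3} (hy : Function.Injective y) (hsep : Sep y) (i : Fin N)
    (hne : ∃ k : Fin N, k ≠ i ∧ dist (y k) (y i) ≤ ϱ) :
    ∃ (M : ℕ) (z : Fin M → E3) (c : Fin M), Function.Injective z ∧ Sep z ∧ (∀ a : Fin M, dist (z a) (z c) ≤ ϱ) ∧
      (∑ a, truncLJ R (dist (z c) (z a))) / 2 - A * densityProxy z c + netInflow F M z c =
        (∑ j, truncLJ R (dist (y i) (y j))) / 2 - A * densityProxy y i + netInflow F N y i ∧
      (∀ η : ℝ, GoodAtScale η D z c → GoodAt η y i) := by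
  set S : Finset (Fin N) := Finset.univ.filter (fun j => dist (y j) (y i) ≤ ϱ) with hS
  have hSdef0 : ∀ j, j ∈ S ↔ dist (y j) (y i) ≤ ϱ := fun j => by simp [hS]
  have hiS : i ∈ S := (hSdef0 i).2 (by rw [dist_self]; exact h0)
  let φ : Fin S.card ↪o Fin N := S.orderEmbOfFin rfl
  have hφ : Set.range φ = ↑S := Finset.range_orderEmbOfFin S rfl
  have hiφ : i ∈ Set.range φ := by rw [hφ]; exact hiS
  obtain ⟨c, hc⟩ := hiφ
  have hSdef : ∀ j, j ∈ S ↔ dist (y j) (y (φ c)) ≤ ϱ := by rw [hc]; exact hSdef0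
  have hSr : ∀ k : Fin N, dist (y k) (y (φ c)) ≤ ϱ → k ∈ Set.range φ := fun k hk => by
    rw [hφ]; exact (hSdef k).2 hk
  have hφinj : Function.Injective φ := φ.injective
  have hne' : ∃ k : Fin N, k ≠ φ c ∧ dist (y k) (y (φ c)) ≤ ϱ := by rw [hc]; exact hne
  refine ⟨S.card, y ∘ φ, c, hy.comp hφinj, fun a b hab => hsep (φ a) (φ b) (hφinj.ne hab), fun a => ?_, ?_, fun η hη => ?_⟩
  · have ha : φ a ∈ S := by
      have h : φ a ∈ Set.range φ := ⟨a, rfl⟩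
      rw [hφ] at h
      exact h
    exact (hSdef (φ a)).1 ha
  · have e1 : ∑ a, truncLJ R (dist ((y ∘ φ) c) ((y ∘ φ) a)) = ∑ j, truncLJ R (dist (y (φ c)) (y j)) :=
      truncSum_motif hR φ hφ hSdef
    have e2 : densityProxy (y ∘ φ) c = densityProxy y (φ c) := densityProxy_motif hφinj hSr hne'
    have e3 : netInflow F S.card (y ∘ φ) c = netInflow F N y (φ c) := netInflow_motif hF₁ hF₂ hRρ hρ hR' φ hφ hSdef
    rw [e1, e2, e3, hc]
  · rw [← hc]; exact goodAt_of_motif hSr hD hη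

/-- ★★ **THE DOOR beneath `T′_R`**: a rule of range `R′`, locality `ρ`, bound `B` whose MOTIF certificate holds on motifs of radius
`ϱ ≥ max (R, 1, R′ + ρ, ρ, R′, 13/10·D + 1)` — with `0 ≤ κ_T, C_T, A` and the isolated-site condition `eUp + κ_T ≤ −A` — is a `LocalDischargingRuleT`.
[folklore] -/
theorem localDischargingRuleT_of_motif {η₀ η₁ R A eUp κT CT D ϱ R' ρ B : ℝ} {F : TransferRule}
    (hF₁ : HasRange R' F) (hF₂ : IsLocal ρ F) (hF₃ : IsBounded B F)
    (hR : R ≤ ϱ) (h1 : 1 ≤ ϱ) (hRρ : R' + ρ ≤ ϱ) (hρ : ρ ≤ ϱ) (hR' : R' ≤ ϱ) (hD : 13 / 10 * D + 1 ≤ ϱ)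
    (hκ : 0 ≤ κT) (hC : 0 ≤ CT) (hA : 0 ≤ A) (hiso : eUp + κT ≤ -A)
    (h : MotifCertificateT η₀ η₁ R A eUp κT CT D ϱ F) :
    LocalDischargingRuleT η₀ η₁ R A eUp κT CT R' ρ B F := by
  refine ⟨hF₁, hF₂, hF₃, fun N y hy hsep i => ?_⟩
  have hi0 : 0 ≤ (if GoodAt η₀ y i then (1 : ℝ) else 0) := by split_ifs <;> norm_num
  have hi1 : 0 ≤ (if GoodAt η₁ y i then (1 : ℝ) else 0) := by split_ifs <;> norm_num
  by_cases hne : ∃ k : Fin N, k ≠ i ∧ dist (y k) (y i) ≤ ϱ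
  · obtain ⟨M, z, c, hz, hzsep, hconf, hrhs, hgood⟩ :=
      motif_transfer (A := A) hF₁ hF₂ (by linarith) hR hRρ hρ hR' hD hy hsep i hne
    have hm := h M z hz hzsep c hconf
    rw [hrhs] at hm
    have e1 := mul_le_mul_of_nonneg_left (ite_le_ite_of_imp (hgood η₁)) hκ
    have e0 := mul_le_mul_of_nonneg_left (ite_le_ite_of_imp (hgood η₀)) hC
    linarith
  · push Not at hne
    have hrhs := rhs_ge_of_isolated hF₁ hR hR' h1 hA (F := F) fun k hk => hne k hk
    have e1 := mul_nonneg hκ hi1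
    have e0 := mul_nonneg hC hi0
    nlinarith

/-- ★★ **THE DOOR beneath `FRG_R`** (`0 ≤ C, A`, isolated-site condition `e₁ ≤ −A`). [folklore] -/
theorem localDischargingRuleF_of_motif {R A e₁ C D ϱ R' ρ B : ℝ} {F : TransferRule}
    (hF₁ : HasRange R' F) (hF₂ : IsLocal ρ F) (hF₃ : IsBounded B F)
    (hR : R ≤ ϱ) (h1 : 1 ≤ ϱ) (hRρ : R' + ρ ≤ ϱ) (hρ : ρ ≤ ϱ) (hR' : R' ≤ ϱ) (hD : 13 / 10 * D + 1 ≤ ϱ)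
    (hC : 0 ≤ C) (hA : 0 ≤ A) (hiso : e₁ ≤ -A)
    (h : MotifCertificateF R A e₁ C D ϱ F) :
    LocalDischargingRuleF R A e₁ C R' ρ B F := by
  refine ⟨hF₁, hF₂, hF₃, fun N y hy hsep i => ?_⟩
  have hi0 : 0 ≤ (if GoodAt (1 / 20) y i then (1 : ℝ) else 0) := by split_ifs <;> norm_num
  by_cases hne : ∃ k : Fin N, k ≠ i ∧ dist (y k) (y i) ≤ ϱ
  · obtain ⟨M, z, c, hz, hzsep, hconf, hrhs, hgood⟩ :=
      motif_transfer (A := A) hF₁ hF₂ (by linarith) hR hRρ hρ hR' hD hy hsep i hne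
    have hm := h M z hz hzsep c hconf
    rw [hrhs] at hm
    have e0 := mul_le_mul_of_nonneg_left (ite_le_ite_of_imp (hgood (1 / 20))) hC
    linarith
  · push Not at hne
    have hrhs := rhs_ge_of_isolated hF₁ hR hR' h1 hA (F := F) fun k hk => hne k hk
    have e0 := mul_nonneg hC hi0
    nlinarith

/-! ## §5. The residuals and the crux BY NAME from motif certificates -/

/-- **`T′_R ⟸ motif certificate`** (through the door). [folklore chaining] -/
theorem finiteRangeTopologicalPricing_of_motif {η₀ η₁ R A eUp κT CT D ϱ R' ρ B : ℝ} {F : TransferRule}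
    (hF₁ : HasRange R' F) (hF₂ : IsLocal ρ F) (hF₃ : IsBounded B F)
    (hR : R ≤ ϱ) (h1 : 1 ≤ ϱ) (hRρ : R' + ρ ≤ ϱ) (hρ : ρ ≤ ϱ) (hR' : R' ≤ ϱ) (hD : 13 / 10 * D + 1 ≤ ϱ)
    (hκ : 0 ≤ κT) (hC : 0 ≤ CT) (hA : 0 ≤ A) (hiso : eUp + κT ≤ -A)
    (h : MotifCertificateT η₀ η₁ R A eUp κT CT D ϱ F) : FiniteRangeTopologicalPricing η₀ η₁ R A eUp κT CT :=
  finiteRangeTopologicalPricing_of_rule (localDischargingRuleT_of_motif hF₁ hF₂ hF₃ hR h1 hRρ hρ hR' hD hκ hC hA hiso h)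

/-- **`FRG_R ⟸ motif certificate`**. [folklore chaining] -/
theorem finiteRangeFrustrationGap_of_motif {R A e₁ C D ϱ R' ρ B : ℝ} {F : TransferRule}
    (hF₁ : HasRange R' F) (hF₂ : IsLocal ρ F) (hF₃ : IsBounded B F)
    (hR : R ≤ ϱ) (h1 : 1 ≤ ϱ) (hRρ : R' + ρ ≤ ϱ) (hρ : ρ ≤ ϱ) (hR' : R' ≤ ϱ) (hD : 13 / 10 * D + 1 ≤ ϱ)
    (hC : 0 ≤ C) (hA : 0 ≤ A) (hiso : e₁ ≤ -A)
    (h : MotifCertificateF R A e₁ C D ϱ F) : FiniteRangeFrustrationGap R A e₁ C :=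
  finiteRangeFrustrationGap_of_rule (localDischargingRuleF_of_motif hF₁ hF₂ hF₃ hR h1 hRρ hρ hR' hD hC hA hiso h)

/-- ★★ **The crux at the residual of record `T′_7` from ONE local rule and its MOTIF certificate** (`R = 7`, `A = 1/324` PROVED floor,
`eUp = −0.7175`, `κ_T = 1/100`; the numeric side conditions `0 ≤ 1/100`, `0 ≤ 1/324`, `−0.7175 + 1/100 ≤ −1/324` discharged):
`MuEquilibriumDoor ∧ E′(1/20,1/8) ∧ UP(−0.7175) ∧ [F : range R′, locality ρ, bound B] ∧ MotifCertificateT (1/20) (1/8) 7 (1/324) (−0.7175) (1/100) C_T D ϱ F`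
`⟹ AperiodicFrustratedLawGap`, for any `C_T ≥ 0`, `D`, and `ϱ ≥ max (7, R′ + ρ, ρ, R′, 13/10·D + 1)`. [folklore chaining] -/
theorem aperiodicFrustratedLawGap_of_motifT_seven {CT D ϱ R' ρ B : ℝ} {F : TransferRule}
    (hDoor : Summit.AtomisticToContinuum.Crystallization.Theses.GrainCoreNetworkSplit.MuEquilibriumDoor)
    (hE : ElasticPricing (1 / 20) (1 / 8)) (hU : PeriodicEnergyCeiling (-(7175 / 10000)))
    (hF₁ : HasRange R' F) (hF₂ : IsLocal ρ F) (hF₃ : IsBounded B F)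
    (hR : 7 ≤ ϱ) (hRρ : R' + ρ ≤ ϱ) (hρ : ρ ≤ ϱ) (hR' : R' ≤ ϱ) (hD : 13 / 10 * D + 1 ≤ ϱ) (hC : 0 ≤ CT)
    (h : MotifCertificateT (1 / 20) (1 / 8) 7 (1 / 324) (-(7175 / 10000)) (1 / 100) CT D ϱ F) :
    Summit.AtomisticToContinuum.Crystallization.Theses.FrustratedLawDichotomy.AperiodicFrustratedLawGap :=
  aperiodicFrustratedLawGap_of_ruleT_seven hDoor hE hU
    (localDischargingRuleT_of_motif hF₁ hF₂ hF₃ hR (by linarith) hRρ hρ hR' hD (by norm_num) hC (by norm_num) (by norm_num) h)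

/-- **The crux from a motif certificate beneath `FRG_7`** (audit twin; level `−0.7174`, `C ≥ 0`). [folklore chaining] -/
theorem aperiodicFrustratedLawGap_of_motifF_seven {C D ϱ R' ρ B : ℝ} {F : TransferRule}
    (hDoor : Summit.AtomisticToContinuum.Crystallization.Theses.GrainCoreNetworkSplit.MuEquilibriumDoor)
    (hU : PeriodicEnergyCeiling (-(7175 / 10000)))
    (hF₁ : HasRange R' F) (hF₂ : IsLocal ρ F) (hF₃ : IsBounded B F)
    (hR : 7 ≤ ϱ) (hRρ : R' + ρ ≤ ϱ) (hρ : ρ ≤ ϱ) (hR' : R' ≤ ϱ) (hD : 13 / 10 * D + 1 ≤ ϱ) (hC : 0 ≤ C)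
    (h : MotifCertificateF 7 (1 / 324) (-(7174 / 10000)) C D ϱ F) :
    Summit.AtomisticToContinuum.Crystallization.Theses.FrustratedLawDichotomy.AperiodicFrustratedLawGap :=
  aperiodicFrustratedLawGap_of_ruleF_seven hDoor hU
    (localDischargingRuleF_of_motif hF₁ hF₂ hF₃ hR (by linarith) hRρ hρ hR' hD hC (by norm_num) (by norm_num) h)

/-- **Generic range**: the crux from E′ ∧ UP ∧ a motif certificate beneath `T′_R` with the layer-cake floor `A_R` (`R > 0`). [folklore chaining] -/
theorem aperiodicFrustratedLawGap_of_motifT_tf {η₁ R eUp κT CT D ϱ R' ρ B : ℝ} {F : TransferRule} (h01 : (1 : ℝ) / 20 ≤ η₁)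
    (hDoor : Summit.AtomisticToContinuum.Crystallization.Theses.GrainCoreNetworkSplit.MuEquilibriumDoor)
    (hE : ElasticPricing (1 / 20) η₁) (hR0 : 0 < R) (hU : PeriodicEnergyCeiling eUp) (hκ : 0 < κT)
    (hF₁ : HasRange R' F) (hF₂ : IsLocal ρ F) (hF₃ : IsBounded B F)
    (hR : R ≤ ϱ) (h1 : 1 ≤ ϱ) (hRρ : R' + ρ ≤ ϱ) (hρ : ρ ≤ ϱ) (hR' : R' ≤ ϱ) (hD : 13 / 10 * D + 1 ≤ ϱ) (hC : 0 ≤ CT)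
    (hiso : eUp + κT ≤ -(4 / 3 * (1 + 1 / (2 * R)) ^ 3 / R ^ 3))
    (h : MotifCertificateT (1 / 20) η₁ R (4 / 3 * (1 + 1 / (2 * R)) ^ 3 / R ^ 3) eUp κT CT D ϱ F) :
    Summit.AtomisticToContinuum.Crystallization.Theses.FrustratedLawDichotomy.AperiodicFrustratedLawGap :=
  aperiodicFrustratedLawGap_of_ruleT_tf h01 hDoor hE hR0 hU hκ
    (localDischargingRuleT_of_motif hF₁ hF₂ hF₃ hR h1 hRρ hρ hR' hD hκ.le hC (by positivity) hiso h)

end Summit.AtomisticToContinuum.Crystallization.Theorems.FrustratedLawDichotomyMotifDoor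

end
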